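import Summits.CriticalPhenomena.SAWScalingLimit.Theorems.SAWLeftRightFKGFKGToTraversalBoundOutlineAbab
import HarnessLib

/-!
# The left-turn step of the wall-follower tour cannot pinch the obstacle path backwards
(witness unit U5c of line `slit-necklace`)

Crux `SAWLeftRightFKG.FKGToTraversalBound` (stmt-CriticalPhenomena-1878), line `slit-necklace`, lead
prover-line-stmt-CriticalPhenomena-1878-c5-0; witness unit U5 (cyclic monotonicity of the contacts of a far piece
along the wall-follower tour), step U5c: the tour TURNS LEFT around an outline site `f` of the free component `A`,
i.e. the consecutive boundary edges `(f, d)` and `(f, d.ccw)` have contacts `r_m = f + d.vec` and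
`r_{m'} = f + d.ccw.vec` on the obstacle path `r` (a far piece of the chord, `r ∩ A = ∅`, all contacts of LEFT
type).  Registered stub `obstacle_step_turn`: `m ≤ m'` (or one of two endpoint wraps).

Proof (discrete planar topology by the tree's combinatorial winding number `walkWinding`, in the style of
`…OutlineAbab` / `…OutlineSide`; no Jordan curve theorem).  Suppose `m' < m`.  Close the sub-path
`r_{m'} … r_m` through the `A`-site `f` into a closed lattice TRAIL `Λ = f → r_{m'} → ⋯ → r_m → f`.
* The block face `φ₀` (corners `f, f + d.vec, f + d.ccw.vec, g`) and the face `φ'` across the `Λ`-edge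
  `{f, r_{m'}}` carry different winding numbers (`abab_walkWinding_ne_of_sepEdge_mem`), and `φ'` agrees with
  the back face `φ'''` (corners `f, f - d.vec, f - d.ccw.vec, …`) across the unused edge `{f - d.vec, f}`.
* `walkWinding Λ φ''' = 0`: the escape `εc` of the `A`-edge `(a₀, c₀)` runs to the far right off `Λ`
  (`walkWinding_eq_zero_of_right`, `walkWinding_eq_of_walk_closed`), and an `A`-walk from `a₀` to `f` enters `f`
  through one of its two free neighbours `f - d.vec`, `f - d.ccw.vec`, corners of `φ'''`
  (`walkWinding_eq_of_mem_corners`).  Hence `walkWinding Λ φ₀ ≠ 0`.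
* `walkWinding Λ φ₀ = 0`: by the LEFT type at `(f, d, m)` either `r_{m+1} = g` is a corner of `φ₀`, or
  `r_{m-1} = r_m - d.ccw.vec`, `r_{m+1} = r_m + d.vec` and `φ₀` agrees with the face across the unused edge
  `{r_m, g}`, a face around `r_{m+1}`; in both cases the forward tail `r_{m+1} … r_L` followed by the escape
  `εv` runs to the far right off `Λ`.
Contradiction; so `m ≤ m'` (the wrap alternatives of the registered signature are not needed under the escape
hypotheses).  All statements folklore (boundary tracing of a polyomino; Kesten, *Percolation theory for
mathematicians* (1982), §2.2 for the winding-number bookkeeping, formalised in `PlanarDuality.lean`); no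
literature fact is introduced; nothing restates the crux.
-/

noncomputable section

open SimpleGraph
open Literature.Probability.LatticeModels Literature.Probability.Percolation
open Literature.Probability.LatticeModels.SquareTiling (corners mem_corners_iff walkWinding_eq_of_mem_corners
  walkWinding_eq_of_walk_closed)

namespace Summit.CriticalPhenomena.SAWScalingLimit.Theorems.FKGToTraversalBound.SlitNecklace

/-! ### Directions and faces of the `2 × 2` block at a left turn -/

/-- Every direction is one of `d`, `d.ccw`, `d.rev`, `d.cw`. [folklore] -/
private theorem turn_dir_cases (d e : ODir) : e = d ∨ e = d.ccw ∨ e = d.rev ∨ e = d.cw := by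
  revert d e
  decide

/-- `d.ccw.vec ≠ -d.ccw.vec`. [folklore] -/
private theorem turn_vec_ne_neg (d : ODir) : d.ccw.vec ≠ -d.ccw.vec := by
  fin_cases d <;> simp [ODir.ccw, ODir.vec, Site.eq_iff_two]

/-- `d.vec + d.ccw.vec ≠ 0` (the diagonal of the block). [folklore] -/
private theorem turn_vec_add_ne_zero (d : ODir) : d.vec + d.ccw.vec ≠ 0 := by
  fin_cases d <;> simp [ODir.ccw, ODir.vec, Site.eq_iff_two]

/-- `x - d.vec ≠ x + d.ccw.vec`. [folklore] -/
private theorem turn_sub_vec_ne (x : Site 2) (d : ODir) : x - d.vec ≠ x + d.ccw.vec := by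
  rw [sub_eq_add_neg, Ne, add_right_inj]
  fin_cases d <;> simp [ODir.ccw, ODir.vec, Site.eq_iff_two]

/-- `x - d.vec ≠ x + d.vec`. [folklore] -/
private theorem turn_sub_vec_ne' (x : Site 2) (d : ODir) : x - d.vec ≠ x + d.vec := by
  rw [sub_eq_add_neg, Ne, add_right_inj]
  fin_cases d <;> simp [ODir.vec, Site.eq_iff_two]

/-- Consecutive faces `cornerFace (x, d)` and `cornerFace (x, d) + d.ccw.vec` are lattice-adjacent
(`adj_cornerFace_add` for a pair in constructor form). [folklore] -/
private theorem turn_adj_face (x : Site 2) (d : ODir) :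
    (zdGraph 2).Adj (cornerFace (x, d)) (cornerFace (x, d) + d.ccw.vec) :=
  ODir.adj_add_vec _ _

/-- The block face `cornerFace (x, d.ccw)` (corners `x, x + d.vec, x + d.ccw.vec, x + d.vec + d.ccw.vec`) is a
face around the diagonal corner `x + d.vec + d.ccw.vec`. [folklore] -/
private theorem turn_blockFace_mem_corners_diag (x : Site 2) (d : ODir) :
    cornerFace (x, d.ccw) + 1 ∈ corners (x + d.vec + d.ccw.vec) := by
  rw [mem_corners_iff]
  fin_cases d <;> simp [ODir.foff, ODir.vec, ODir.ccw]

/-- The block face `cornerFace (x, d.ccw)` is a face around the corner `x + d.vec`. [folklore] -/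
private theorem turn_blockFace_mem_corners_vec (x : Site 2) (d : ODir) :
    cornerFace (x, d.ccw) + 1 ∈ corners (x + d.vec) := by
  rw [mem_corners_iff]
  fin_cases d <;> simp [ODir.foff, ODir.vec, ODir.ccw]

/-- The block face of `x` is the end face of the boundary edge `(x + d.vec, d.ccw)`. [folklore] -/
private theorem turn_blockFace_shift (x : Site 2) (d : ODir) :
    cornerFace (x + d.vec, d.ccw) + d.ccw.ccw.vec = cornerFace (x, d.ccw) := by
  ext i; fin_cases d <;> fin_cases i <;> simp [ODir.foff, ODir.ccw, ODir.vec]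

/-- The face across `{x, x + d.ccw.vec}` from the block face is the end face of the boundary edge
`(x - d.vec, d)`. [folklore] -/
private theorem turn_sideFace_eq (x : Site 2) (d : ODir) :
    cornerFace (x - d.vec, d) + d.ccw.vec = cornerFace (x, d.ccw) + d.ccw.ccw.vec := by
  ext i; fin_cases d <;> fin_cases i <;> simp [ODir.foff, ODir.ccw, ODir.vec] <;> omega

/-- The back face `cornerFace (x - d.vec, d)` (corners `x, x - d.vec, x - d.ccw.vec, x - d.vec - d.ccw.vec`) is a
face around `x - d.ccw.vec`. [folklore] -/
private theorem turn_backFace_mem_corners (x : Site 2) (d : ODir) :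
    cornerFace (x - d.vec, d) + 1 ∈ corners (x - d.ccw.vec) := by
  rw [mem_corners_iff]
  fin_cases d <;> simp [ODir.foff, ODir.vec, ODir.ccw]

/-- A closed walk winds equally about a face `φ` around a site `q` off the walk and about the face `q`.
[folklore] -/
private theorem turn_face_site {a : Site 2} (Λ : (zdGraph 2).Walk a a) {q φ : Site 2} (hq : q ∉ Λ.support)
    (hφ : φ + 1 ∈ corners q) : walkWinding Λ φ = walkWinding Λ q := by
  have h1 := walkWinding_eq_of_mem_corners Λ hq hφ
  have h2 := walkWinding_eq_of_mem_corners Λ hq (c := q + 1) (by rw [mem_corners_iff]; simp)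
  rw [add_sub_cancel_right] at h1 h2
  exact h1.trans h2.symm

/-! ### Sub-paths and the approach to the base site -/

/-- **Sub-path of a path between two indices**, with its vertices and edges listed by index. [folklore] -/
private theorem turn_subwalk {u v : Site 2} (r : (zdGraph 2).Walk u v) (hr : r.IsPath) (i : ℕ) :
    ∀ j, i ≤ j → j ≤ r.length → ∃ q : (zdGraph 2).Walk (r.getVert i) (r.getVert j), q.IsPath ∧
      (∀ z ∈ q.support, ∃ k, i ≤ k ∧ k ≤ j ∧ z = r.getVert k) ∧
      (∀ e ∈ q.edges, ∃ k, i ≤ k ∧ k < j ∧ e = s(r.getVert k, r.getVert (k + 1))) := by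
  intro j hij
  induction j, hij using Nat.le_induction with
  | base =>
    intro
    exact ⟨Walk.nil, Walk.IsPath.nil, fun z hz => ⟨i, le_rfl, le_rfl, by simpa using hz⟩,
      fun e he => by simp at he⟩
  | succ j hij ih =>
    intro hj
    obtain ⟨q, hq, hs, he⟩ := ih (Nat.le_of_succ_le hj)
    have hadj : (zdGraph 2).Adj (r.getVert j) (r.getVert (j + 1)) := r.adj_getVert_succ hj
    refine ⟨q.concat hadj, hq.concat (fun hmem => ?_) hadj, fun z hz => ?_, fun e he' => ?_⟩
    · obtain ⟨k, -, hkj, hk⟩ := hs _ hmem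
      have := hr.getVert_injOn (by simpa using hj) (by simp; omega) hk
      omega
    · rw [Walk.support_concat, List.mem_append, List.mem_singleton] at hz
      rcases hz with hz | rfl
      · obtain ⟨k, hik, hkj, hk⟩ := hs z hz
        exact ⟨k, hik, by omega, hk⟩
      · exact ⟨j + 1, by omega, le_rfl, rfl⟩
    · rw [Walk.edges_concat, List.concat_eq_append, List.mem_append, List.mem_singleton] at he'
      rcases he' with he' | rfl
      · obtain ⟨k, hik, hkj, hk⟩ := he e he'
        exact ⟨k, hik, by omega, hk⟩
      · exact ⟨j, hij, Nat.lt_succ_self j, rfl⟩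

/-- **Approaching the base site.**  If every lattice neighbour of `f` off the closed walk `Λ` reads the winding
number of the face `φ`, then so does the start of every lattice walk to `f` that stays off `Λ` before reaching `f`.
[folklore] -/
private theorem turn_winding_reach {a f : Site 2} (Λ : (zdGraph 2).Walk a a) (φ : Site 2)
    (hnb : ∀ y, (zdGraph 2).Adj y f → y ∉ Λ.support → walkWinding Λ y = walkWinding Λ φ) {x : Site 2}
    (π : (zdGraph 2).Walk x f) (hπ : ∀ z ∈ π.support, z ≠ f → z ∉ Λ.support) (hx : x ≠ f) :
    walkWinding Λ x = walkWinding Λ φ := by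
  induction π with
  | nil => exact absurd rfl hx
  | cons h π' ih =>
    rename_i x y f
    have hxΛ : x ∉ Λ.support := hπ x (Walk.start_mem_support _) hx
    by_cases hy : y = f
    · subst hy
      exact hnb x h hxΛ
    · have hyΛ : y ∉ Λ.support := hπ y (by simp) hy
      rw [← ih hnb (fun z hz hzf => hπ z (by simp [hz]) hzf) hy]
      refine walkWinding_eq_of_walk_closed Λ (Walk.cons h Walk.nil) fun z hz => ?_
      rw [Walk.support_cons, Walk.support_nil, List.mem_cons, List.mem_singleton] at hz
      rcases hz with rfl | rfl
      exacts [hxΛ, hyΛ]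

/-! ### The registered stub -/

/-- **Registered stub (witness unit U5c): the left-turn step of the tour does not decrease the obstacle contact
index.**  Setting: `A` the free component (`4`-connected), `r` the obstacle path (`r ∩ A = ∅`, all contacts of
LEFT type), escapes `εv`, `εc` to the far right off `A` and off the interior of `r`; the tour turns left around
`f ∈ A` with contacts `r_m = f + d.vec`, `r_{m'} = f + d.ccw.vec`.  Then `m ≤ m'` (first alternative; the two
endpoint-wrap alternatives are vacuous here): a backward pinch `m' < m` would close the pocket
`f → r_{m'} → ⋯ → r_m → f`, about whose block face the winding number is both `±1` (jump across the used edge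
`{f, r_{m'}}`, the back faces of `f` being joined to the far right by the `A`-edge escape) and `0` (the forward tail
of `r` and `εv`). [folklore] -/
theorem obstacle_step_turn : ∀ (A : Finset (Site 2)) {u v : Site 2} (r : (zdGraph 2).Walk u v) (Rbig : ℤ) (u₁ v₁ a₀ c₀ c₁ : Site 2) (εu : (zdGraph 2).Walk u u₁) (εv : (zdGraph 2).Walk v v₁) (εc : (zdGraph 2).Walk c₀ c₁) (f : Site 2) (d : ODir) (m m' : ℕ), r.IsPath → 2 ≤ r.length → 2 ≤ A.card → (∀ x ∈ A, ∀ y ∈ A, ∃ w : (zdGraph 2).Walk x y, ∀ z ∈ w.support, z ∈ A) → (∀ z ∈ r.support, z ∉ A) → (∀ (f' : Site 2) (d' : ODir) (n : ℕ), f' ∈ A → 0 < n → n < r.length → r.getVert n = f' + d'.vec → (r.getVert (n + 1) = r.getVert n + d'.ccw.vec ∨ r.getVert (n - 1) = r.getVert n - d'.ccw.vec)) → (∀ z : Site 2, (z ∈ A ∨ z ∈ r.support) → z 0 + 2 ≤ Rbig) → Rbig ≤ u₁ 0 → Rbig ≤ v₁ 0 → Rbig ≤ c₁ 0 → (∀ z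 ∈ εu.support, z ∉ A ∧ ∀ n, 0 < n → n < r.length → z ≠ r.getVert n) → (∀ z ∈ εv.support, z ∉ A ∧ ∀ n, 0 < n → n < r.length → z ≠ r.getVert n) → a₀ ∈ A → c₀ ∉ A → (zdGraph 2).Adj a₀ c₀ → (∀ n, 0 < n → n < r.length → c₀ ≠ r.getVert n) → (∀ z ∈ εc.support, z ∉ A ∧ ∀ n, 0 < n → n < r.length → z ≠ r.getVert n) → f ∈ A → 0 < m → m < r.length → 0 < m' → m' < r.length → r.getVert m = f + d.vec → r.getVert m' = f + d.ccw.vec → (m ≤ m' ∨ (m + 1 = r.length ∧ m' + 2 ≤ m ∧ r.getVert r.length = f + d.vec + d.ccw.vec ∧ r.getVert (m' - 1) = r.getVert m' + d.ccw.vec) ∨ (m' = 1 ∧ 3 ≤ m ∧ r.getVert 0 = f + d.vec + d.ccw.vec ∧ r.getVert (m + 1) = r.getVert m + d.vec)) := by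
  intro A u v r Rbig u₁ v₁ a₀ c₀ c₁ εu εv εc f d m m' hr _ _ hA hrA hleft hR _ hv₁ hc₁ _ hεv ha₀ hc₀ hac hc₀r
    hεc hf hm0 hmL hm'0 hm'L hm hm'
  rcases le_or_gt m m' with hle | hlt
  · exact Or.inl hle
  exfalso
  -- bookkeeping on the path `r`
  have hinj : ∀ i j, i ≤ r.length → j ≤ r.length → r.getVert i = r.getVert j → i = j :=
    fun i j hi hj h => hr.getVert_injOn (by simpa using hi) (by simpa using hj) h
  have hfr : f ∉ r.support := fun h => hrA f h hf
  -- the pocket `Λ = f → r_{m'} → ⋯ → r_m → f`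
  obtain ⟨q, hq, hqs, hqe⟩ := turn_subwalk r hr m' m hlt.le hmL.le
  have hadj1 : (zdGraph 2).Adj f (r.getVert m') := by rw [hm']; exact ODir.adj_add_vec f d.ccw
  have hadj2 : (zdGraph 2).Adj (r.getVert m) f := by rw [hm]; exact (ODir.adj_add_vec f d).symm
  obtain ⟨Λ, hΛ⟩ : ∃ Λ : (zdGraph 2).Walk f f, Λ = Walk.cons hadj1 (q.concat hadj2) := ⟨_, rfl⟩
  have hΛs : ∀ z ∈ Λ.support, z = f ∨ ∃ k, m' ≤ k ∧ k ≤ m ∧ z = r.getVert k := by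
    intro z hz
    rw [hΛ, Walk.support_cons, Walk.support_concat, List.mem_cons, List.mem_append, List.mem_singleton] at hz
    rcases hz with h | h | h
    exacts [Or.inl h, Or.inr (hqs z h), Or.inl h]
  have hΛe : ∀ e ∈ Λ.edges, e = s(f, r.getVert m') ∨
      (∃ k, m' ≤ k ∧ k < m ∧ e = s(r.getVert k, r.getVert (k + 1))) ∨ e = s(r.getVert m, f) := by
    intro e he
    rw [hΛ, Walk.edges_cons, Walk.edges_concat, List.mem_cons, List.concat_eq_append, List.mem_append,
      List.mem_singleton] at he
    rcases he with h | h | h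
    exacts [Or.inl h, Or.inr (Or.inl (hqe e h)), Or.inr (Or.inr h)]
  have hmΛ : r.getVert m ∈ Λ.support := by
    rw [hΛ, Walk.support_cons, Walk.support_concat]
    exact List.mem_cons_of_mem _ (List.mem_append_left _ (Walk.end_mem_support q))
  have hm'Λ : r.getVert m' ∈ Λ.support := by
    rw [hΛ, Walk.support_cons, Walk.support_concat]
    exact List.mem_cons_of_mem _ (List.mem_append_left _ (Walk.start_mem_support q))
  -- sites off the pocket
  have hoff : ∀ z, z ∉ A → (∀ n, 0 < n → n < r.length → z ≠ r.getVert n) → z ∉ Λ.support := by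
    intro z hzA hzr hz
    rcases hΛs z hz with rfl | ⟨k, hk1, hk2, rfl⟩
    · exact hzA hf
    · exact hzr k (by omega) (by omega) rfl
  have hoffA : ∀ z ∈ A, z ≠ f → z ∉ Λ.support := by
    intro z hzA hzf hz
    rcases hΛs z hz with h | ⟨k, -, -, rfl⟩
    · exact hzf h
    · exact hrA _ (Walk.getVert_mem_support r k) hzA
  have hoffr : ∀ k, m < k → k ≤ r.length → r.getVert k ∉ Λ.support := by
    intro k hk1 hk2 hz
    rcases hΛs _ hz with h | ⟨k', -, hk'2, h⟩
    · exact hfr (h ▸ Walk.getVert_mem_support r k)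
    · have := hinj k k' hk2 (by omega) h
      omega
  have hΛR : ∀ z ∈ Λ.support, z 0 ≤ Rbig := by
    intro z hz
    rcases hΛs z hz with rfl | ⟨k, -, -, rfl⟩
    · have := hR _ (Or.inl hf); omega
    · have := hR _ (Or.inr (Walk.getVert_mem_support r k)); omega
  -- the pocket is a closed trail
  have hΛn : Λ.edges.Nodup := by
    rw [hΛ, Walk.edges_cons, Walk.edges_concat, List.concat_eq_append, List.nodup_cons]
    refine ⟨fun h => ?_, List.nodup_append.2 ⟨hq.isTrail.edges_nodup, List.nodup_singleton _, ?_⟩⟩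
    · rcases List.mem_append.1 h with h | h
      · obtain ⟨k, -, -, rfl⟩ := hqs _ (q.fst_mem_support_of_mem_edges h)
        exact hfr (Walk.getVert_mem_support r k)
      · rw [List.mem_singleton] at h
        rcases Sym2.eq_iff.1 h with ⟨h1, -⟩ | ⟨-, h2⟩
        · exact hfr (h1 ▸ Walk.getVert_mem_support r m)
        · have := hinj m' m hm'L.le hmL.le h2
          omega
    · rintro e he _ he' rfl
      rw [List.mem_singleton] at he'
      subst he'
      obtain ⟨k, -, -, hk⟩ := hqs _ (q.snd_mem_support_of_mem_edges he)
      exact hfr (hk ▸ Walk.getVert_mem_support r k)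
  -- (1) the jump across the used edge `{f, r_{m'}}`: block face `φ₀ = cornerFace (f, d.ccw)` versus `φ'`
  have hjump : walkWinding Λ (cornerFace (f, d.ccw)) ≠ walkWinding Λ (cornerFace (f, d.ccw) + d.ccw.ccw.vec) := by
    refine abab_walkWinding_ne_of_sepEdge_mem hΛn (turn_adj_face f d.ccw) ?_
    rw [sepEdge_cornerFace, ← hm', hΛ, Walk.edges_cons]
    exact List.mem_cons_self
  -- (2) the back face `φ''' = cornerFace (f - d.vec, d)` agrees with `φ'` across the unused edge `{f - d.vec, f}`
  have hside : walkWinding Λ (cornerFace (f - d.vec, d)) =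
      walkWinding Λ (cornerFace (f, d.ccw) + d.ccw.ccw.vec) := by
    rw [← turn_sideFace_eq]
    refine walkWinding_closed_eq_of_adj (turn_adj_face (f - d.vec) d) fun hmem => ?_
    rw [sepEdge_cornerFace, sub_add_cancel] at hmem
    rcases hΛe _ hmem with h | ⟨k, -, -, h⟩ | h
    · rcases Sym2.eq_iff.1 h with ⟨-, h2⟩ | ⟨h1, -⟩
      · exact hfr (h2 ▸ Walk.getVert_mem_support r m')
      · exact turn_sub_vec_ne f d (h1.trans hm')
    · have hf2 : f ∈ (s(r.getVert k, r.getVert (k + 1)) : Sym2 (Site 2)) := by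
        rw [← h]; exact Sym2.mem_mk_right _ _
      rcases Sym2.mem_iff.1 hf2 with h' | h' <;> exact hfr (h' ▸ Walk.getVert_mem_support r _)
    · rcases Sym2.eq_iff.1 h with ⟨h1, -⟩ | ⟨-, h2⟩
      · exact turn_sub_vec_ne' f d (h1.trans hm)
      · exact hfr (h2 ▸ Walk.getVert_mem_support r m)
  -- (3) the back face reads `0`: approach `f` from the `A`-edge `(a₀, c₀)`, whose escape runs to the far right
  have hnb : ∀ y, (zdGraph 2).Adj y f → y ∉ Λ.support →
      walkWinding Λ y = walkWinding Λ (cornerFace (f - d.vec, d)) := by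
    intro y hy hyΛ
    obtain ⟨e, rfl⟩ := ODir.exists_eq_add_vec_of_adj hy.symm
    rcases turn_dir_cases d e with rfl | rfl | rfl | rfl
    · exact absurd (hm ▸ hmΛ) hyΛ
    · exact absurd (hm' ▸ hm'Λ) hyΛ
    · rw [ODir.vec_rev, ← sub_eq_add_neg] at hyΛ ⊢
      exact (turn_face_site Λ hyΛ (cornerFace_add_one_mem_corners _ _)).symm
    · rw [ODir.vec_cw, ← sub_eq_add_neg] at hyΛ ⊢
      exact (turn_face_site Λ hyΛ (turn_backFace_mem_corners f d)).symm
  obtain ⟨ω, hω⟩ := hA a₀ ha₀ f hf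
  have hc₀Λ : c₀ ∉ Λ.support := hoff c₀ hc₀ hc₀r
  have hreach := turn_winding_reach Λ _ hnb (Walk.cons hac.symm ω) (fun z hz hzf => ?_)
    (fun h => hc₀ (h ▸ hf))
  swap
  · rw [Walk.support_cons, List.mem_cons] at hz
    rcases hz with rfl | hz
    exacts [hc₀Λ, hoffA z (hω z hz) hzf]
  have hc₀0 : walkWinding Λ c₀ = 0 := by
    rw [walkWinding_eq_of_walk_closed Λ εc fun z hz => hoff z (hεc z hz).1 (hεc z hz).2]
    exact Literature.Probability.LatticeModels.walkWinding_eq_zero_of_right hΛR hc₁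
  have hφ₀ : walkWinding Λ (cornerFace (f, d.ccw)) ≠ 0 := by
    intro h0
    apply hjump
    rw [h0, ← hside, ← hreach, hc₀0]
  -- (4) every vertex of `r` beyond index `m` reads `0` (forward tail of `r`, then `εv`)
  have htail : ∀ k, m < k → k ≤ r.length → walkWinding Λ (r.getVert k) = 0 := by
    intro k hk1 hk2
    obtain ⟨q', -, hq's, -⟩ := turn_subwalk r hr k r.length hk2 le_rfl
    rw [walkWinding_eq_of_walk_closed Λ q' fun z hz => ?_, Walk.getVert_length,
      walkWinding_eq_of_walk_closed Λ εv fun z hz => hoff z (hεv z hz).1 (hεv z hz).2]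
    · exact Literature.Probability.LatticeModels.walkWinding_eq_zero_of_right hΛR hv₁
    · obtain ⟨k', hk'1, hk'2, rfl⟩ := hq's z hz
      exact hoffr k' (by omega) hk'2
  have hoff1 : r.getVert (m + 1) ∉ Λ.support := hoffr (m + 1) (Nat.lt_succ_self m) hmL
  -- (5) the LEFT type at `(f, d, m)`
  have hL1 : r.getVert (m + 1) ≠ r.getVert m + d.ccw.vec := by
    intro hL1
    -- `r_{m+1} = g` is a corner of the block face
    refine hφ₀ ((turn_face_site Λ hoff1 ?_).trans (htail (m + 1) (Nat.lt_succ_self m) hmL))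
    rw [hL1, hm]
    exact turn_blockFace_mem_corners_diag f d
  rcases hleft f d m hf hm0 hmL hm with h | hL2
  · exact hL1 h
  -- `r_{m-1} = r_m - d.ccw.vec`, hence `r_{m+1} = r_m + d.vec`
  have hsucc : r.getVert (m + 1) = r.getVert m + d.vec := by
    obtain ⟨e, he⟩ := ODir.exists_eq_add_vec_of_adj (r.adj_getVert_succ hmL)
    rcases turn_dir_cases d e with rfl | rfl | rfl | rfl
    · exact he
    · exact absurd he hL1
    · exfalso
      rw [ODir.vec_rev, hm, add_neg_cancel_right] at he
      exact hfr (he ▸ Walk.getVert_mem_support r (m + 1))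
    · exfalso
      rw [ODir.vec_cw, ← sub_eq_add_neg, ← hL2] at he
      have := hinj (m + 1) (m - 1) hmL (by omega) he
      omega
  -- the edge `{r_m, g}` is not a `Λ`-edge …
  have hedge : s(r.getVert m, r.getVert m + d.ccw.vec) ∉ Λ.edges := by
    intro hmem
    rcases hΛe _ hmem with h | ⟨k, -, hk2, h⟩ | h
    · rcases Sym2.eq_iff.1 h with ⟨h1, -⟩ | ⟨h1, -⟩
      · exact hfr (h1 ▸ Walk.getVert_mem_support r m)
      · have := hinj m m' hmL.le hm'L.le h1
        omega
    · rcases Sym2.eq_iff.1 h with ⟨h1, -⟩ | ⟨h1, h2⟩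
      · have := hinj m k hmL.le (by omega) h1
        omega
      · have := hinj m (k + 1) hmL.le (by omega) h1
        obtain rfl : k = m - 1 := by omega
        rw [hL2, sub_eq_add_neg] at h2
        exact turn_vec_ne_neg d (add_left_cancel h2)
    · rcases Sym2.eq_iff.1 h with ⟨-, h2⟩ | ⟨h1, -⟩
      · rw [hm, add_assoc, add_eq_left] at h2
        exact turn_vec_add_ne_zero d h2
      · exact hfr (h1 ▸ Walk.getVert_mem_support r m)
  -- … so the block face agrees with the face `cornerFace (r_m, d.ccw)` around `r_{m+1}`, which reads `0`
  have hE : walkWinding Λ (cornerFace (r.getVert m, d.ccw)) = walkWinding Λ (cornerFace (f, d.ccw)) := by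
    have h := walkWinding_closed_eq_of_adj (p := Λ) (turn_adj_face (r.getVert m) d.ccw)
      (by rwa [sepEdge_cornerFace])
    rw [h, hm, turn_blockFace_shift]
  refine hφ₀ (hE.symm.trans ((turn_face_site Λ hoff1 ?_).trans (htail (m + 1) (Nat.lt_succ_self m) hmL)))
  rw [hsucc]
  exact turn_blockFace_mem_corners_vec _ d

end Summit.CriticalPhenomena.SAWScalingLimit.Theorems.FKGToTraversalBound.SlitNecklace

end
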